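import Literature.AlgebraicGeometry.Motives.MixedHodgeStructureAbelian
import Literature.AlgebraicGeometry.Motives.MixedHodgeExtension
import HarnessLib

/-!
# Bigraded sections and retractions of morphisms of mixed Hodge structures

Deligne, *Théorie de Hodge II*, 1.2.8–1.2.11 and Thm. 2.3.5: the canonical splitting
`V_ℂ = ⊕_{p,q} I^{p,q}` (`W_n ⊗ ℂ = ⊕_{p+q ≤ n} I^{p,q}`, `F^p = ⊕_{p' ≥ p} I^{p',q}`) of a mixed Hodge
structure is functorial — every morphism `f : H₁ → H₂` satisfies `f_ℂ(I^{p,q}(H₁)) ⊆ I^{p,q}(H₂)`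
(Cattani–El Zein–Griffiths–Lê, *Hodge Theory*, Prop. 3.2.19 and Remark (ii); the tree's
`MixedHodgeStructure.Hom.map_deligneI_le`, `isInternal_deligneFamily`, `F_eq_iSup_deligneI`,
`baseChange_W_eq_iSup_deligneI`). This file draws the linear-algebra consequences used by the
theory of extensions of (not necessarily separated) mixed Hodge structures
(`MixedHodgeExtensionNonSeparated.lean`; Carlson, *Extensions of mixed Hodge structures* (1980),
§2; Brylinski–Zucker, *An overview of recent advances in Hodge theory* (1990/1998), Prop. 5.22):

* §1 `IsBigraded H₁ H₂ φ` — a `ℂ`-linear `φ : V₁_ℂ → V₂_ℂ` mapping each `I^{p,q}(H₁)` into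
  `I^{p,q}(H₂)`; such a map preserves `F` (`IsBigraded.map_F_le`) and `W ⊗ ℂ`
  (`IsBigraded.map_baseChange_W_le`) and commutes with the `I^{p,q}`-components
  (`IsBigraded.decompose_apply`); `Hom.isBigraded`.
* §2 **`Hom.map_deligneI_eq_of_surjective`** — a surjective morphism maps `I^{p,q}(H₁)` ONTO
  `I^{p,q}(H₂)`, and **`Hom.exists_isBigraded_section`** — it admits a `ℂ`-linear section compatible
  with the bigradings, hence with `W ⊗ ℂ` and `F` simultaneously (the bifiltered refinement of the
  tree's `exists_filteredSection`; Carlson 1980, §2(d) "there is always a section of the Hodge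
  filtration", here chosen compatible with the weights as well).
* §3 **`Hom.mem_deligneI_of_apply_mem`** — for an injective morphism, `f_ℂ x ∈ I^{p,q}(H₂)` forces
  `x ∈ I^{p,q}(H₁)`, and **`Hom.exists_isBigraded_retraction`** — an injective morphism admits a
  bigraded `ℂ`-linear retraction.
* §4 over `ℚ`: **`Hom.exists_section_map_W_le`** / **`Hom.exists_retraction_map_W_le`** — a
  surjective (resp. injective) morphism admits a `ℚ`-linear section (resp. retraction) compatible
  with the weight filtrations (strictness for `W`, Deligne Thm. 2.3.5 (iii), plus the filtered-section
  lemma `exists_filteredSection`; the retraction through a filtered section of the cokernel);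
  `map_baseChange_le_of_map_le` — the complexified compatibility.

All statements are proved; no named facts.

## References

* [DeligneHodgeII1971] P. Deligne, Théorie de Hodge II, Publ. Math. IHÉS 40 (1971), 1.2.8–1.2.11,
  Thm. 2.3.5.
* [CattaniElZeinGriffithsLe2014] E. Cattani et al. (eds.), Hodge Theory (2014), Prop. 3.2.19 and
  Remark (ii), Lemma 3.2.20 (pp. 159–161).
* [Carlson1980] J. A. Carlson, Extensions of mixed Hodge structures, Journées de géométrie
  algébrique d'Angers 1979 (1980), §2(d).
* [BrylinskiZucker1998] J.-L. Brylinski, S. Zucker, An overview of recent advances in Hodge theory,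
  Several Complex Variables VI, Encyclopaedia Math. Sci. 69, Springer (1990); reprinted in
  Complex Manifolds, Springer (1998), 39–142: Prop. 5.22.
-/

open scoped TensorProduct DirectSum

noncomputable section

namespace Literature.AlgebraicGeometry.Motives

namespace MixedHodgeStructure

universe u v w

variable {V : Type u} [AddCommGroup V] [Module ℚ V]
variable {V' : Type v} [AddCommGroup V'] [Module ℚ V']
variable {V'' : Type w} [AddCommGroup V''] [Module ℚ V'']

open DirectSum

/-! ### §1 Bigraded maps -/

/-- A `ℂ`-linear map `φ : V_ℂ → V'_ℂ` is **bigraded** (for the mixed Hodge structures `H₁`, `H₂`)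
if it maps Deligne's `I^{p,q}(H₁)` into `I^{p,q}(H₂)` for all `p, q` — the property enjoyed by
(complexified) morphisms of MHS (Cattani–El Zein–Griffiths–Lê, Remark (ii) after Prop. 3.2.19:
"a morphism of MHS is necessarily compatible with this decomposition").
[cite: CattaniElZeinGriffithsLe2014, Prop. 3.2.19, Remark (ii)] -/
def IsBigraded (H₁ : MixedHodgeStructure V) (H₂ : MixedHodgeStructure V')
    (φ : ℂ ⊗[ℚ] V →ₗ[ℂ] ℂ ⊗[ℚ] V') : Prop :=
  ∀ p q : ℤ, (H₁.deligneI p q).map φ ≤ H₂.deligneI p q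

/-- **Morphisms of MHS are bigraded** (Cattani et al., Remark (ii) after Prop. 3.2.19; the
tree's `Hom.map_deligneI_le`). [cite: CattaniElZeinGriffithsLe2014, Prop. 3.2.19, Remark (ii)] -/
theorem Hom.isBigraded {H₁ : MixedHodgeStructure V} {H₂ : MixedHodgeStructure V'} (f : Hom H₁ H₂) :
    IsBigraded H₁ H₂ (f.toLinearMap.baseChange ℂ) :=
  f.map_deligneI_le

namespace IsBigraded

variable {H₁ : MixedHodgeStructure V} {H₂ : MixedHodgeStructure V'} {H₃ : MixedHodgeStructure V''}
variable {φ : ℂ ⊗[ℚ] V →ₗ[ℂ] ℂ ⊗[ℚ] V'}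

/-- A bigraded map sends elements of `I^{p,q}` to `I^{p,q}`.
[cite: CattaniElZeinGriffithsLe2014, Prop. 3.2.19, Remark (ii)] -/
theorem apply_mem (h : IsBigraded H₁ H₂ φ) {p q : ℤ} {x : ℂ ⊗[ℚ] V} (hx : x ∈ H₁.deligneI p q) :
    φ x ∈ H₂.deligneI p q :=
  h p q ⟨x, hx, rfl⟩

/-- The identity is bigraded. [cite: CattaniElZeinGriffithsLe2014, Prop. 3.2.19, Remark (ii)] -/
protected theorem id : IsBigraded H₁ H₁ LinearMap.id := fun p q => by
  rw [Submodule.map_id]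

/-- The zero map is bigraded. [cite: CattaniElZeinGriffithsLe2014, Prop. 3.2.19, Remark (ii)] -/
protected theorem zero : IsBigraded H₁ H₂ 0 := fun p q => by
  rw [Submodule.map_zero]
  exact bot_le

/-- Composites of bigraded maps are bigraded.
[cite: CattaniElZeinGriffithsLe2014, Prop. 3.2.19, Remark (ii)] -/
theorem comp {ψ : ℂ ⊗[ℚ] V' →ₗ[ℂ] ℂ ⊗[ℚ] V''} (hψ : IsBigraded H₂ H₃ ψ) (hφ : IsBigraded H₁ H₂ φ) :
    IsBigraded H₁ H₃ (ψ ∘ₗ φ) := fun p q => by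
  rw [Submodule.map_comp]
  exact (Submodule.map_mono (hφ p q)).trans (hψ p q)

/-- Sums of bigraded maps are bigraded. [cite: CattaniElZeinGriffithsLe2014, Prop. 3.2.19, Remark (ii)] -/
theorem add {φ' : ℂ ⊗[ℚ] V →ₗ[ℂ] ℂ ⊗[ℚ] V'} (h : IsBigraded H₁ H₂ φ) (h' : IsBigraded H₁ H₂ φ') :
    IsBigraded H₁ H₂ (φ + φ') := fun p q => by
  rintro _ ⟨x, hx, rfl⟩
  exact (H₂.deligneI p q).add_mem (h.apply_mem hx) (h'.apply_mem hx)

/-- Differences of bigraded maps are bigraded.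
[cite: CattaniElZeinGriffithsLe2014, Prop. 3.2.19, Remark (ii)] -/
theorem sub {φ' : ℂ ⊗[ℚ] V →ₗ[ℂ] ℂ ⊗[ℚ] V'} (h : IsBigraded H₁ H₂ φ) (h' : IsBigraded H₁ H₂ φ') :
    IsBigraded H₁ H₂ (φ - φ') := fun p q => by
  rintro _ ⟨x, hx, rfl⟩
  exact (H₂.deligneI p q).sub_mem (h.apply_mem hx) (h'.apply_mem hx)

/-- **A bigraded map preserves the Hodge filtrations**: `φ(F^p H₁) ⊆ F^p H₂`, because
`F^p = ⊕_{p' ≥ p} I^{p',q}` (Cattani et al., Prop. 3.2.19). [cite: CattaniElZeinGriffithsLe2014, Prop. 3.2.19] -/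
theorem map_F_le (h : IsBigraded H₁ H₂ φ) (p : ℤ) : (H₁.F p).map φ ≤ H₂.F p := by
  rw [H₁.F_eq_iSup_deligneI p, H₂.F_eq_iSup_deligneI p]
  simp only [Submodule.map_iSup]
  exact iSup_mono fun r => iSup_mono fun _ => iSup_mono fun s => h r s

/-- **A bigraded map preserves the complexified weight filtrations**: `φ(W_k H₁ ⊗ ℂ) ⊆ W_k H₂ ⊗ ℂ`,
because `W_k ⊗ ℂ = ⊕_{p+q ≤ k} I^{p,q}` (Cattani et al., Prop. 3.2.19).
[cite: CattaniElZeinGriffithsLe2014, Prop. 3.2.19] -/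
theorem map_baseChange_W_le (h : IsBigraded H₁ H₂ φ) (k : ℤ) :
    ((H₁.W k).baseChange ℂ).map φ ≤ (H₂.W k).baseChange ℂ := by
  rw [H₁.baseChange_W_eq_iSup_deligneI k, H₂.baseChange_W_eq_iSup_deligneI k]
  simp only [Submodule.map_iSup]
  exact iSup_mono fun m => iSup_mono fun _ => iSup_mono fun p => h p (m - p)

section Decompose

variable [DirectSum.Decomposition H₁.deligneFamily] [DirectSum.Decomposition H₂.deligneFamily]

/-- **A bigraded map commutes with the `I^{p,q}`-components**: the `(p,q)`-component of `φ x` is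
`φ` of the `(p,q)`-component of `x` (both decompositions `V_ℂ = ⊕ I^{p,q}` being direct,
Cattani et al., Prop. 3.2.19). [cite: CattaniElZeinGriffithsLe2014, Prop. 3.2.19] -/
theorem decompose_apply (h : IsBigraded H₁ H₂ φ) (x : ℂ ⊗[ℚ] V) (pq : ℤ × ℤ) :
    (decompose H₂.deligneFamily (φ x) pq : ℂ ⊗[ℚ] V') =
      φ (decompose H₁.deligneFamily x pq : ℂ ⊗[ℚ] V) := by
  have hx : x ∈ ⨆ s, H₁.deligneFamily s := by
    rw [H₁.iSup_deligneFamily_eq_top]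
    exact Submodule.mem_top
  refine Submodule.iSup_induction H₁.deligneFamily
    (motive := fun x => (decompose H₂.deligneFamily (φ x) pq : ℂ ⊗[ℚ] V') =
      φ (decompose H₁.deligneFamily x pq : ℂ ⊗[ℚ] V)) hx (fun s y hy => ?_) ?_ (fun a b ha hb => ?_)
  · have hφy : φ y ∈ H₂.deligneFamily s := h s.1 s.2 ⟨y, hy, rfl⟩
    by_cases hs : s = pq
    · subst hs
      rw [decompose_of_mem_same H₁.deligneFamily hy, decompose_of_mem_same H₂.deligneFamily hφy]
    · rw [decompose_of_mem_ne H₁.deligneFamily hy hs, decompose_of_mem_ne H₂.deligneFamily hφy hs,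
        map_zero]
  · simp only [map_zero, decompose_zero, DirectSum.zero_apply, ZeroMemClass.coe_zero]
  · simp only [map_add, decompose_add, DirectSum.add_apply, Submodule.coe_add, ha, hb]

end Decompose

end IsBigraded

/-! ### §2 Surjective morphisms: `I^{p,q}` maps onto `I^{p,q}`; bigraded sections -/

namespace Hom

variable {H₁ : MixedHodgeStructure V} {H₂ : MixedHodgeStructure V'}

/-- **A surjective morphism of MHS maps `I^{p,q}(H₁)` onto `I^{p,q}(H₂)`**: if `f_ℂ x = y ∈ I^{p,q}`,
the `(p,q)`-component of `x` already maps to `y` (morphisms commute with the components,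
Cattani et al., Remark (ii) after Prop. 3.2.19; this is the graded form of the strictness
Deligne, Hodge II, Thm. 2.3.5 (iii)). [cite: CattaniElZeinGriffithsLe2014, Prop. 3.2.19, Remark (ii)] -/
theorem map_deligneI_eq_of_surjective (f : Hom H₁ H₂) (hf : Function.Surjective f.toLinearMap)
    (p q : ℤ) : (H₁.deligneI p q).map (f.toLinearMap.baseChange ℂ) = H₂.deligneI p q := by
  classical
  letI : DirectSum.Decomposition H₁.deligneFamily := H₁.isInternal_deligneFamily.chooseDecomposition
  letI : DirectSum.Decomposition H₂.deligneFamily := H₂.isInternal_deligneFamily.chooseDecomposition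
  refine le_antisymm (f.map_deligneI_le p q) fun y hy => ?_
  obtain ⟨x, rfl⟩ := LinearMap.baseChange_surjective ℂ hf y
  refine ⟨(decompose H₁.deligneFamily x (p, q) : ℂ ⊗[ℚ] V), H₁.decompose_mem x (p, q), ?_⟩
  rw [← f.isBigraded.decompose_apply x (p, q)]
  exact decompose_of_mem_same H₂.deligneFamily (i := (p, q)) hy

/-- **A surjective morphism of MHS admits a bigraded `ℂ`-linear section** `s : V'_ℂ → V_ℂ`,
`f_ℂ ∘ s = id`, `s(I^{p,q}(H₂)) ⊆ I^{p,q}(H₁)` — hence a section compatible with `W ⊗ ℂ` AND `F`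
(`IsBigraded.map_baseChange_W_le`, `IsBigraded.map_F_le`): choose a section of each surjection
`I^{p,q}(H₁) → I^{p,q}(H₂)` (`map_deligneI_eq_of_surjective`) and add them up over the direct sum
`V'_ℂ = ⊕ I^{p,q}(H₂)`. This refines Carlson's "there is always a section of the Hodge filtration"
(1980, §2(d)) to a section of both filtrations. [cite: Carlson1980, §2(d)] -/
theorem exists_isBigraded_section (f : Hom H₁ H₂) (hf : Function.Surjective f.toLinearMap) :
    ∃ s : ℂ ⊗[ℚ] V' →ₗ[ℂ] ℂ ⊗[ℚ] V,
      f.toLinearMap.baseChange ℂ ∘ₗ s = LinearMap.id ∧ IsBigraded H₂ H₁ s := by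
  classical
  letI : DirectSum.Decomposition H₂.deligneFamily := H₂.isInternal_deligneFamily.chooseDecomposition
  set fC := f.toLinearMap.baseChange ℂ with hfC
  have hres : ∀ pq : ℤ × ℤ, ∀ x : H₁.deligneFamily pq, fC (x : ℂ ⊗[ℚ] V) ∈ H₂.deligneFamily pq :=
    fun pq x => f.map_deligneI_le pq.1 pq.2 ⟨x, x.2, rfl⟩
  let fpq : ∀ pq : ℤ × ℤ, H₁.deligneFamily pq →ₗ[ℂ] H₂.deligneFamily pq := fun pq =>
    (fC ∘ₗ (H₁.deligneFamily pq).subtype).codRestrict _ (hres pq)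
  have hfpq : ∀ pq (x : H₁.deligneFamily pq), (fpq pq x : ℂ ⊗[ℚ] V') = fC x := fun _ _ => rfl
  have hsurj : ∀ pq, Function.Surjective (fpq pq) := fun pq => by
    rintro ⟨y, hy⟩
    have hy' : y ∈ (H₁.deligneI pq.1 pq.2).map fC := by
      rw [hfC, f.map_deligneI_eq_of_surjective hf]
      exact hy
    obtain ⟨x, hx, rfl⟩ := hy'
    exact ⟨⟨x, hx⟩, rfl⟩
  choose g hg using fun pq =>
    (fpq pq).exists_rightInverse_of_surjective (LinearMap.range_eq_top.2 (hsurj pq))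
  let s : ℂ ⊗[ℚ] V' →ₗ[ℂ] ℂ ⊗[ℚ] V :=
    DirectSum.toModule ℂ (ℤ × ℤ) (ℂ ⊗[ℚ] V) (fun pq => (H₁.deligneFamily pq).subtype ∘ₗ g pq) ∘ₗ
      (DirectSum.decomposeLinearEquiv H₂.deligneFamily).toLinearMap
  have hs_of : ∀ (pq : ℤ × ℤ) (y : ℂ ⊗[ℚ] V') (hy : y ∈ H₂.deligneFamily pq),
      s y = (g pq ⟨y, hy⟩ : ℂ ⊗[ℚ] V) := fun pq y hy => by
    simp only [s, LinearMap.comp_apply, LinearEquiv.coe_coe, decomposeLinearEquiv_apply,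
      decompose_of_mem H₂.deligneFamily hy, ← lof_eq_of ℂ, toModule_lof, Submodule.subtype_apply]
  have hfs : ∀ y, fC (s y) = y := fun y => by
    have hy : y ∈ ⨆ pq, H₂.deligneFamily pq := by
      rw [H₂.iSup_deligneFamily_eq_top]
      exact Submodule.mem_top
    refine Submodule.iSup_induction H₂.deligneFamily (motive := fun y => fC (s y) = y) hy
      (fun pq y hy => ?_) (by rw [map_zero, map_zero]) (fun a b ha hb => by
        rw [map_add, map_add, ha, hb])
    rw [hs_of pq y hy, ← hfpq]
    have := LinearMap.congr_fun (hg pq) ⟨y, hy⟩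
    rw [LinearMap.comp_apply, LinearMap.id_apply] at this
    exact congrArg Subtype.val this
  refine ⟨s, LinearMap.ext hfs, fun p q => ?_⟩
  rintro _ ⟨y, hy, rfl⟩
  rw [hs_of (p, q) y hy]
  exact (g (p, q) ⟨y, hy⟩).2

/-! ### §3 Injective morphisms: `f_ℂ⁻¹(I^{p,q}) = I^{p,q}`; bigraded retractions -/

/-- **For an injective morphism, `f_ℂ x ∈ I^{p,q}(H₂)` forces `x ∈ I^{p,q}(H₁)`**: the other
components of `x` map to the (vanishing) other components of `f_ℂ x`, so vanish by injectivity
(Cattani et al., Remark (ii) after Prop. 3.2.19 with the directness of `⊕ I^{p,q}`; the graded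
form of the strictness of injections). [cite: CattaniElZeinGriffithsLe2014, Prop. 3.2.19, Remark (ii)] -/
theorem mem_deligneI_of_apply_mem (f : Hom H₁ H₂) (hf : Function.Injective f.toLinearMap)
    {p q : ℤ} {x : ℂ ⊗[ℚ] V} (hx : f.toLinearMap.baseChange ℂ x ∈ H₂.deligneI p q) :
    x ∈ H₁.deligneI p q := by
  classical
  letI : DirectSum.Decomposition H₁.deligneFamily := H₁.isInternal_deligneFamily.chooseDecomposition
  letI : DirectSum.Decomposition H₂.deligneFamily := H₂.isInternal_deligneFamily.chooseDecomposition
  have hinj := baseChange_injective (V := V') hf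
  have hzero : ∀ s : ℤ × ℤ, s ≠ (p, q) → (decompose H₁.deligneFamily x s : ℂ ⊗[ℚ] V) = 0 := by
    intro s hs
    apply hinj
    rw [map_zero, ← f.isBigraded.decompose_apply x s]
    exact decompose_of_mem_ne H₂.deligneFamily (i := (p, q)) hx (Ne.symm hs)
  rw [← sum_support_decompose H₁.deligneFamily x]
  refine Submodule.sum_mem _ fun s _ => ?_
  by_cases h : s = (p, q)
  · subst h
    exact H₁.decompose_mem x (p, q)
  · rw [hzero s h]
    exact zero_mem _

/-- For an injective morphism, `f_ℂ⁻¹(I^{p,q}(H₂)) = I^{p,q}(H₁)`.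
[cite: CattaniElZeinGriffithsLe2014, Prop. 3.2.19, Remark (ii)] -/
theorem comap_deligneI_eq_of_injective (f : Hom H₁ H₂) (hf : Function.Injective f.toLinearMap)
    (p q : ℤ) : (H₂.deligneI p q).comap (f.toLinearMap.baseChange ℂ) = H₁.deligneI p q :=
  le_antisymm (fun _ hx => f.mem_deligneI_of_apply_mem hf hx)
    (Submodule.map_le_iff_le_comap.1 (f.map_deligneI_le p q))

/-- **An injective morphism of MHS admits a bigraded `ℂ`-linear retraction** `r : V'_ℂ → V_ℂ`,
`r ∘ f_ℂ = id`, `r(I^{p,q}(H₂)) ⊆ I^{p,q}(H₁)` — hence compatible with `W ⊗ ℂ` and `F`: choose a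
retraction of each injection `I^{p,q}(H₁) → I^{p,q}(H₂)` and add them up over
`V'_ℂ = ⊕ I^{p,q}(H₂)` (Cattani et al., Prop. 3.2.19 with Remark (ii); the bigraded analogue of
Carlson's integral retractions, 1980, §2(b)). [cite: Carlson1980, §2(b)] -/
theorem exists_isBigraded_retraction (f : Hom H₁ H₂) (hf : Function.Injective f.toLinearMap) :
    ∃ r : ℂ ⊗[ℚ] V' →ₗ[ℂ] ℂ ⊗[ℚ] V,
      r ∘ₗ f.toLinearMap.baseChange ℂ = LinearMap.id ∧ IsBigraded H₂ H₁ r := by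
  classical
  letI : DirectSum.Decomposition H₂.deligneFamily := H₂.isInternal_deligneFamily.chooseDecomposition
  set fC := f.toLinearMap.baseChange ℂ with hfC
  have hinj := baseChange_injective (V := V') hf
  have hres : ∀ pq : ℤ × ℤ, ∀ x : H₁.deligneFamily pq, fC (x : ℂ ⊗[ℚ] V) ∈ H₂.deligneFamily pq :=
    fun pq x => f.map_deligneI_le pq.1 pq.2 ⟨x, x.2, rfl⟩
  let fpq : ∀ pq : ℤ × ℤ, H₁.deligneFamily pq →ₗ[ℂ] H₂.deligneFamily pq := fun pq =>
    (fC ∘ₗ (H₁.deligneFamily pq).subtype).codRestrict _ (hres pq)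
  have hfpq : ∀ pq (x : H₁.deligneFamily pq), (fpq pq x : ℂ ⊗[ℚ] V') = fC x := fun _ _ => rfl
  have hinj' : ∀ pq, Function.Injective (fpq pq) := fun pq x y hxy => by
    apply Subtype.ext
    apply hinj
    rw [← hfpq, ← hfpq, hxy]
  choose l hl using fun pq =>
    (fpq pq).exists_leftInverse_of_injective (LinearMap.ker_eq_bot.2 (hinj' pq))
  let r : ℂ ⊗[ℚ] V' →ₗ[ℂ] ℂ ⊗[ℚ] V :=
    DirectSum.toModule ℂ (ℤ × ℤ) (ℂ ⊗[ℚ] V) (fun pq => (H₁.deligneFamily pq).subtype ∘ₗ l pq) ∘ₗ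
      (DirectSum.decomposeLinearEquiv H₂.deligneFamily).toLinearMap
  have hr_of : ∀ (pq : ℤ × ℤ) (y : ℂ ⊗[ℚ] V') (hy : y ∈ H₂.deligneFamily pq),
      r y = (l pq ⟨y, hy⟩ : ℂ ⊗[ℚ] V) := fun pq y hy => by
    simp only [r, LinearMap.comp_apply, LinearEquiv.coe_coe, decomposeLinearEquiv_apply,
      decompose_of_mem H₂.deligneFamily hy, ← lof_eq_of ℂ, toModule_lof, Submodule.subtype_apply]
  have hrf : ∀ x, r (fC x) = x := fun x => by
    letI : DirectSum.Decomposition H₁.deligneFamily :=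
      H₁.isInternal_deligneFamily.chooseDecomposition
    have hx : x ∈ ⨆ pq, H₁.deligneFamily pq := by
      rw [H₁.iSup_deligneFamily_eq_top]
      exact Submodule.mem_top
    refine Submodule.iSup_induction H₁.deligneFamily (motive := fun x => r (fC x) = x) hx
      (fun pq x hx => ?_) (by rw [map_zero, map_zero]) (fun a b ha hb => by
        rw [map_add, map_add, ha, hb])
    rw [hr_of pq (fC x) (hres pq ⟨x, hx⟩)]
    have := LinearMap.congr_fun (hl pq) ⟨x, hx⟩
    rw [LinearMap.comp_apply, LinearMap.id_apply] at this
    exact congrArg Subtype.val this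
  refine ⟨r, LinearMap.ext hrf, fun p q => ?_⟩
  rintro _ ⟨y, hy, rfl⟩
  rw [hr_of (p, q) y hy]
  exact (l (p, q) ⟨y, hy⟩).2

/-! ### §4 Rational sections and retractions compatible with the weight filtrations -/

/-- **A surjective morphism of MHS admits a `ℚ`-linear section compatible with the weight
filtrations**: `f ∘ s = id`, `s(W_k H₂) ⊆ W_k H₁` — from the strictness `f(W_k H₁) = W_k H₂`
(Deligne, Hodge II, Thm. 2.3.5 (iii)) and the filtered-section lemma `exists_filteredSection`
(applied to the decreasing filtration `k ↦ W_{-k}`). [cite: DeligneHodgeII1971, Thm. 2.3.5 (iii)] -/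
theorem exists_section_map_W_le (f : Hom H₁ H₂) (hf : Function.Surjective f.toLinearMap) :
    ∃ s : V' →ₗ[ℚ] V, f.toLinearMap ∘ₗ s = LinearMap.id ∧ ∀ k, (H₂.W k).map s ≤ H₁.W k := by
  have hπ : ∀ p : ℤ, (H₁.W (-p)).map f.toLinearMap = H₂.W (-p) := fun p => by
    rw [f.isStrict.map_W, LinearMap.range_eq_top.2 hf, inf_top_eq]
  obtain ⟨t, ht⟩ := H₂.exists_W_eq_top
  obtain ⟨b, hb⟩ := H₂.exists_W_eq_bot
  obtain ⟨s, hs, hsW⟩ := exists_filteredSection f.toLinearMap (fun p => H₂.W (-p))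
    (fun p => H₁.W (-p)) (fun _ _ h => H₂.monotone_W (neg_le_neg h))
    (fun _ _ h => H₁.monotone_W (neg_le_neg h)) hπ ⟨-t, by rwa [neg_neg]⟩ ⟨-b, by rwa [neg_neg]⟩
  exact ⟨s, hs, fun k => by simpa using hsW (-k)⟩

/-- **An injective morphism of MHS admits a `ℚ`-linear retraction compatible with the weight
filtrations**: `r ∘ f = id`, `r(W_k H₂) ⊆ W_k H₁`. Proof: the cokernel `V' → V'/f(V)` with the
quotient filtration is a strict surjection, so has a filtered section `σ` (`exists_filteredSection`);
`r := f⁻¹ ∘ (id - σ ∘ proj)` is a retraction, and `W`-compatible by the strictness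
`f(W_k H₁) = W_k H₂ ∩ f(V)` (Deligne, Hodge II, Thm. 2.3.5 (iii)). [cite: DeligneHodgeII1971, Thm. 2.3.5 (iii)] -/
theorem exists_retraction_map_W_le (f : Hom H₁ H₂) (hf : Function.Injective f.toLinearMap) :
    ∃ r : V' →ₗ[ℚ] V, r ∘ₗ f.toLinearMap = LinearMap.id ∧ ∀ k, (H₂.W k).map r ≤ H₁.W k := by
  set N : Submodule ℚ V' := LinearMap.range f.toLinearMap with hN
  -- the quotient filtration on the cokernel and a filtered section of the projection
  have hπ : ∀ p : ℤ, (H₂.W (-p)).map N.mkQ = (H₂.W (-p)).map N.mkQ := fun _ => rfl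
  obtain ⟨t, ht⟩ := H₂.exists_W_eq_top
  obtain ⟨b, hb⟩ := H₂.exists_W_eq_bot
  obtain ⟨σ, hσ, hσW⟩ := exists_filteredSection N.mkQ (fun p => (H₂.W (-p)).map N.mkQ)
    (fun p => H₂.W (-p)) (fun _ _ h => Submodule.map_mono (H₂.monotone_W (neg_le_neg h)))
    (fun _ _ h => H₂.monotone_W (neg_le_neg h)) hπ
    ⟨-t, by rw [neg_neg, ht, Submodule.map_top, Submodule.range_mkQ]⟩
    ⟨-b, by rw [neg_neg, hb, Submodule.map_bot]⟩
  -- `id - σ ∘ proj` takes values in `N = f(V)`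
  have hrange : LinearMap.range (LinearMap.id - σ ∘ₗ N.mkQ) ≤ LinearMap.range f.toLinearMap := by
    rintro _ ⟨x, rfl⟩
    have hker : ((LinearMap.id : V' →ₗ[ℚ] V') - σ ∘ₗ N.mkQ) x ∈ LinearMap.ker N.mkQ := by
      have h1 := LinearMap.congr_fun hσ (N.mkQ x)
      rw [LinearMap.comp_apply, LinearMap.id_apply] at h1
      rw [LinearMap.mem_ker, LinearMap.sub_apply, map_sub, LinearMap.comp_apply, h1,
        LinearMap.id_apply, sub_self]
    rw [Submodule.ker_mkQ] at hker
    exact hker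
  refine ⟨liftOfRangeLE f.toLinearMap hf _ hrange, ?_, fun k => ?_⟩
  · refine LinearMap.ext fun x => hf ?_
    rw [LinearMap.comp_apply, apply_liftOfRangeLE, LinearMap.id_apply, LinearMap.sub_apply,
      LinearMap.comp_apply, LinearMap.id_apply]
    have : N.mkQ (f.toLinearMap x) = 0 := by
      rw [← LinearMap.mem_ker, Submodule.ker_mkQ]
      exact LinearMap.mem_range_self _ _
    rw [this, map_zero, sub_zero]
  · rintro _ ⟨x, hx, rfl⟩
    -- `f (r x) = x - σ(proj x) ∈ W_k H₂ ∩ f(V) = f(W_k H₁)`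
    have hmem : f.toLinearMap (liftOfRangeLE f.toLinearMap hf _ hrange x) ∈
        (H₁.W k).map f.toLinearMap := by
      rw [f.isStrict.map_W k, apply_liftOfRangeLE]
      refine ⟨(H₂.W k).sub_mem hx ?_, hrange (LinearMap.mem_range_self _ x)⟩
      have h' := hσW (-k) ⟨N.mkQ x, ⟨x, by simpa using hx, rfl⟩, rfl⟩
      simpa using h'
    obtain ⟨y, hy, he⟩ := hmem
    rwa [← hf he]

end Hom

/-- Complexifying a compatibility `g(P) ⊆ Q` of `ℚ`-subspaces: `g_ℂ(P ⊗ ℂ) ⊆ Q ⊗ ℂ` (as for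
morphisms of MHS, whose complexifications preserve `W ⊗ ℂ`: Cattani et al., §3.2.2.2; the tree's
`Hom.map_baseChange_W_le`). [cite: CattaniElZeinGriffithsLe2014, §3.2.2.2] -/
theorem map_baseChange_le_of_map_le {g : V →ₗ[ℚ] V'} {P : Submodule ℚ V} {Q : Submodule ℚ V'}
    (h : P.map g ≤ Q) : (P.baseChange ℂ).map (g.baseChange ℂ) ≤ Q.baseChange ℂ := by
  rw [map_baseChange_baseChange]
  exact Submodule.baseChange_mono ℂ h

end MixedHodgeStructure

end Literature.AlgebraicGeometry.Motives

end
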